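import Summits.Ventures.CertifiedQuantumChemistry.Certificates.HubbardRingL6LiftCoeffRows
import HarnessLib

/-!
# Ventures/CertifiedQuantumChemistry — Certificates/HubbardRingL6LiftQMapRows0.lean: the HEAVY kernel identity `Q_0 = qMapP6 (γ_0, Γ_0)` of the
# coefficient `j = 0` of the L = 6 lift, on the 144 ordered-pair codes

HONEST FRAMING (verbatim): certified bounds for a stated model Hamiltonian in a stated basis; not a
claim about the real molecule beyond that model. Auxiliary objects only (coefficients of a polynomial family of relaxation
variables of the half-filled Hubbard 6-ring's level-DQG programme); no model energy is bounded here.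

Seat rdm-B (gen 43; layer 2(a′) of the L = 6 lift assembly, plan `tools/x14-g42/l6/MEMO-L6-KERNEL-FLOOR.md` §8; the `L = 6` twin of
`…L4LiftCoeffRows.lean` §2 / `…L4LiftGMapRows.lean`, one identity per file because of kernel time). THE OBJECTS: `Γ_j = l6GG j`
(`…L6LiftPairPSD.lean`) and `Q_j = l6QQ j` (`…L6LiftPairPSD.lean`) — rational `144 × 144` matrices on the pair codes `I = 12·x + y`, DEFINED as
(signed) scatter-sums of the landed block tables — and `γ_j = l6Gam j`, `qMapP6`, `gamO`, `GamO`, `toFin6` (`…L6LiftCoeffRows.lean`).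
THE THEOREM **`l6QQ_eq_qMapP0`**: for all codes `I J`, `l6QQ 0 I J = toFin6 (qMapP6 true (gamO (l6Gam 0)) (GamO (l6GG 0))) I J` (the `Q`-map's affine constant rides on `j = 0` only) — i.e. the
`Q` block tables certified PSD in layer 1 ARE Mazziotti's `Q`-map of `(γ_0, Γ_0)`, entry by entry. Kernel evaluation in three row
chunks of 48 (measured ≈ 1.6 s per row of 144 entries on the farm; the file ≈ 4 min of kernel time); verified offline first in exact
arithmetic on the tree's tables (`tools/x14-g43/l6/verify6.py`: 0 / 20 736 violations). NOT a row of `CERTIFIED.md`, no claim node;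
S-U UNTOUCHED. 0 sorry, 0 def, standard axioms.
-/

set_option linter.style.longLine false

namespace Summit.Ventures.CertifiedQuantumChemistry

namespace LiftL6

set_option maxHeartbeats 4000000 in
/-- Rows `I < 48` of `Q_0 = qMapP6 (γ_0, Γ_0)` (kernel evaluation). -/
theorem l6QQ_eq_qMapP0_c0 : ∀ I J : Fin 144, (I : ℕ) < 48 → l6QQ 0 I J = toFin6 (qMapP6 true (gamO (l6Gam 0)) (GamO (l6GG 0))) I J := by
  decide +kernel

set_option maxHeartbeats 4000000 in
/-- Rows `48 ≤ I < 96` of `Q_0 = qMapP6 (γ_0, Γ_0)` (kernel evaluation). -/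
theorem l6QQ_eq_qMapP0_c1 : ∀ I J : Fin 144, 48 ≤ (I : ℕ) → (I : ℕ) < 96 → l6QQ 0 I J = toFin6 (qMapP6 true (gamO (l6Gam 0)) (GamO (l6GG 0))) I J := by
  decide +kernel

set_option maxHeartbeats 4000000 in
/-- Rows `96 ≤ I` of `Q_0 = qMapP6 (γ_0, Γ_0)` (kernel evaluation). -/
theorem l6QQ_eq_qMapP0_c2 : ∀ I J : Fin 144, 96 ≤ (I : ℕ) → l6QQ 0 I J = toFin6 (qMapP6 true (gamO (l6Gam 0)) (GamO (l6GG 0))) I J := by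
  decide +kernel

/-- **`Q_0 = qMapP6 (γ_0, Γ_0)` on all `144 × 144` codes** (assembled from the three row chunks). -/
theorem l6QQ_eq_qMapP0 (I J : Fin 144) : l6QQ 0 I J = toFin6 (qMapP6 true (gamO (l6Gam 0)) (GamO (l6GG 0))) I J := by
  rcases Nat.lt_or_ge (I : ℕ) 48 with h | h
  · exact l6QQ_eq_qMapP0_c0 I J h
  rcases Nat.lt_or_ge (I : ℕ) 96 with h' | h'
  · exact l6QQ_eq_qMapP0_c1 I J h h'
  · exact l6QQ_eq_qMapP0_c2 I J h'

end LiftL6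

end Summit.Ventures.CertifiedQuantumChemistry
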